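import Summits.FinalStateConjecture.FinalStateConjecture.Theorems.ClusterCompletenessAdiabaticMultiKerrILEDZoneDisjoint
import Summits.FinalStateConjecture.FinalStateConjecture.Theorems.ClusterCompletenessAdiabaticMultiKerrILEDField
import Literature.Geometry.Lorentzian.KerrSchildMultiplierCurrent

/-!
# Route ClusterCompleteness — crux `AdiabaticMultiKerrILED`, line `Sketch`: the boosted time
# translation is Killing for the patched field in its zone

Helper file for the crux `stmt-FinalStateConjecture-14310`
(`Summit.FinalStateConjecture.FinalStateConjecture.Theses.ClusterCompleteness.AdiabaticMultiKerrILED`),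
closing the stub `stub_zoneKilling` of line `Sketch` (brick B1 of the late-time Killing-energy analysis).

The patched inverse metric of the crux is `G = η − Σⱼ termⱼ` with
`termⱼ(y) = χ(rⱼ(qⱼ y)) · 2Hⱼ(qⱼ y) · (Λⱼℓ♯ⱼ(qⱼ y))^α (Λⱼℓ♯ⱼ(qⱼ y))^β`, `χ(r) = smoothTransition (2 − r/8M)`
(`= 0` for `r ≥ 16M`, `Theorems.cruxCutoff_eq_zero`), `qⱼ = poincareInv Λⱼ (0, pⱼ)` the affine map to the
rest frame of hole `j`, which moves with the constant `4`-velocity `uⱼ = Λⱼ e₀`.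

* The own term of hole `i` is invariant under the boosted time translation `y ↦ y + s uᵢ`:
  `qᵢ(y + s uᵢ) = qᵢ y + s e₀` (`Λᵢ⁻¹ uᵢ = e₀`) and the Kerr–Schild data `r`, `H`, `ℓ♯` are stationary
  (`Kerr.radius_add_time_smul_basisVector`, `Kerr.scalarH_add_smul_basisVector_zero`,
  `Kerr.nullVector_add_smul_basisVector_zero`; Kerr–Schild 1965, §2).
* At a lab point `x` with `x⁰ ≥ 0` and `rᵢ ≤ 17Mᵢ`, zone disjointness (`stub_zoneDisjoint`) gives
  `rⱼ > 17Mⱼ > 16Mⱼ` for every `j ≠ i`, an open condition (`Kerr.continuous_radius`,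
  `continuous_poincareInv`), so on a neighbourhood of `x` all other terms vanish and `G = η − termᵢ`.

Hence `s ↦ G(x + s uᵢ)^{αβ}` is constant near `s = 0`, and by uniqueness of line derivatives
(`HasLineDerivAt.unique`) the directional derivative `DG^{αβ}(x) uᵢ` vanishes; expanding
`uᵢ = Σ_μ uᵢ^μ ∂_μ` (`Kerr.eq_sum_basisVector`) this is `Σ_μ uᵢ^μ ∂_μ G^{αβ}(x) = 0`, so the bulk term
`K^X = −½ Σ_μ X^μ Σ_{αβ} ∂_μ G^{αβ} ∂_αw ∂_βw` of the constant multiplier `X = uᵢ`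
(`KerrSchild.multiplierBulk_of_fderiv_eq_zero`) is zero: `uᵢ·∂` is Killing for the PATCHED field in
zone `i`. Dafermos–Rodnianski–Shlapentokh-Rothman arXiv:1402.7034, §2.3.1 (`K^T = 0` for a Killing
`T`); Kerr–Schild 1965, §2 (stationarity); O'Neill 1983, Ch. 9 (boosts). [folklore]
-/

noncomputable section

-- the doubled `FinalStateConjecture.FinalStateConjecture` path component trips dupNamespace
set_option linter.dupNamespace false

open scoped InnerProductSpace BigOperators Topology
open Filter Literature.Geometry.Lorentzian

namespace Summit.FinalStateConjecture.FinalStateConjecture.Cruxes.AdiabaticMultiKerrILED.Sketch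

/-- The inverse Poincaré map is affine with linear part `Λ⁻¹`:
`Λ⁻¹((y + s v) − c) = Λ⁻¹(y − c) + s Λ⁻¹ v` (O'Neill 1983, Ch. 9, p. 236). [folklore] -/
private theorem poincareInv_add_smul (Λ : lorentzGroup) (c y v : E4) (s : ℝ) :
    poincareInv Λ c (y + s • v) = poincareInv Λ c y + s • (Λ : E4 ≃L[ℝ] E4).symm v := by
  simp only [poincareInv, add_sub_right_comm, map_add, map_smul]

/-- **The boosted time translation `uᵢ·∂` is Killing for the patched field in zone `i`.** Under the
crux hypotheses (`uᵢ = Λᵢ e₀`, `qᵢ = poincareInv Λᵢ (0, pᵢ)`, `Mᵢ > 0`, `|aᵢ| ≤ Mᵢ/2`, lab speeds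
`≤ 1/2`, separation `≥ 40 (Mᵢ + Mⱼ)` and strict recession at `t = 0`, `G` the tails-cut patched field),
at every lab point `x` with `x⁰ ≥ 0` and `rᵢ(qᵢ x) ≤ 17Mᵢ` the directional derivative of every
component `G^{αβ}` along `uᵢ` vanishes, and the bulk term `K^{uᵢ}` of the constant multiplier
`X = uᵢ` is zero for every `w`. Proof: the own term of hole `i` is invariant under `y ↦ y + s uᵢ`
(`qᵢ(y + s uᵢ) = qᵢ y + s e₀`, stationarity of `r`, `H`, `ℓ♯`), all other terms vanish near `x`
(zone disjointness `rⱼ > 17Mⱼ`, openness, `χⱼ = 0` for `rⱼ ≥ 16Mⱼ`), so `s ↦ G^{αβ}(x + s uᵢ)` is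
locally constant and `DG^{αβ}(x) uᵢ = 0` by uniqueness of line derivatives; then
`K^{uᵢ} = −½ Σ_{αβ} (DG^{αβ}(x) uᵢ) ∂_αw ∂_βw = 0`. DRSR arXiv:1402.7034, §2.3.1; Kerr–Schild 1965,
§2; O'Neill 1983, Ch. 9. [folklore] -/
theorem stub_zoneKilling :
    ∀ {N : ℕ} (M a : Fin N → ℝ) (Λ : Fin N → lorentzGroup) (p : Fin N → E3) (u : Fin N → E4)
      (q : Fin N → E4 → E4),
      (∀ i, u i = (Λ i : E4 ≃L[ℝ] E4) (E4.basisVector 0)) →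
      (∀ i x, q i x = poincareInv (Λ i) (E4.ofTimeSpace 0 (p i)) x) →
      (∀ i, 0 < M i) → (∀ i, |a i| ≤ 2⁻¹ * M i) →
      (∀ i, 0 < u i 0 ∧ ‖E4.spatial (u i)‖ ≤ 2⁻¹ * u i 0) →
      (∀ i j, i ≠ j → 40 * (M i + M j) ≤ dist (p i) (p j) ∧
        0 < ⟪p i - p j, (u i 0)⁻¹ • E4.spatial (u i) - (u j 0)⁻¹ • E4.spatial (u j)⟫_ℝ) →
      ∀ (G : E4 → Fin 4 → Fin 4 → ℝ),
      (∀ x μ ν, G x μ ν = Minkowski.bilin (E4.basisVector μ) (E4.basisVector ν) -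
        ∑ i, Real.smoothTransition (2 - Kerr.radius (a i) (q i x) / (8 * M i)) *
          (2 * Kerr.scalarH (M i) (a i) (q i x)) *
          ((Λ i : E4 ≃L[ℝ] E4) (Kerr.nullVector (a i) (q i x))) μ *
          ((Λ i : E4 ≃L[ℝ] E4) (Kerr.nullVector (a i) (q i x))) ν) →
      ∀ x : E4, 0 ≤ x 0 → ∀ i, 0 < Kerr.radius (a i) (q i x) → Kerr.radius (a i) (q i x) ≤ 17 * M i →
        (∀ α β : Fin 4, fderiv ℝ (fun y ↦ G y α β) x (u i) = 0) ∧
        ∀ w : E4 → ℝ, KerrSchild.multiplierBulk G (fun _ κ ↦ (u i) κ) w x = 0 := by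
  intro N M a Λ p u q hu hq hM ha hv hsep G hG x hx0 i _ h17
  -- name the Kerr–Schild term of hole `j`
  obtain ⟨T, hT⟩ : ∃ T : Fin N → E4 → Fin 4 → Fin 4 → ℝ, ∀ j y α β,
      Real.smoothTransition (2 - Kerr.radius (a j) (q j y) / (8 * M j)) *
        (2 * Kerr.scalarH (M j) (a j) (q j y)) *
        ((Λ j : E4 ≃L[ℝ] E4) (Kerr.nullVector (a j) (q j y))) α *
        ((Λ j : E4 ≃L[ℝ] E4) (Kerr.nullVector (a j) (q j y))) β = T j y α β :=
    ⟨_, fun _ _ _ _ ↦ rfl⟩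
  have hG' : ∀ (y : E4) (μ ν : Fin 4),
      G y μ ν = Minkowski.bilin (E4.basisVector μ) (E4.basisVector ν) - ∑ j, T j y μ ν := by
    intro y μ ν
    rw [hG]
    simp only [hT]
  -- (1) the rest-frame map intertwines the boosted time translation with `+ s e₀`, and the own
  -- term of hole `i` is stationary
  have hshift : ∀ (y : E4) (s : ℝ), q i (y + s • u i) = q i y + s • E4.basisVector 0 := by
    intro y s
    rw [hq, hq, poincareInv_add_smul, hu i, ContinuousLinearEquiv.symm_apply_apply]
  have hTi : ∀ (y : E4) (s : ℝ) (α β : Fin 4), T i (y + s • u i) α β = T i y α β := by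
    intro y s α β
    rw [← hT, ← hT, hshift, Kerr.radius_add_time_smul_basisVector,
      Kerr.scalarH_add_smul_basisVector_zero, Kerr.nullVector_add_smul_basisVector_zero]
  -- (2) near `x` only the term of hole `i` is present (zone disjointness is an open condition)
  have hnear : ∀ᶠ y in 𝓝 x, ∀ j, j ≠ i → 16 * M j < Kerr.radius (a j) (q j y) := by
    refine Filter.eventually_all.2 fun j ↦ ?_
    by_cases hji : j = i
    · exact Filter.Eventually.of_forall fun y h ↦ absurd hji h
    · have h17j : 17 * M j < Kerr.radius (a j) (q j x) :=
        stub_zoneDisjoint M a Λ p u q hu hq hM ha hv hsep x hx0 i j (Ne.symm hji) h17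
      have h16 : 16 * M j < Kerr.radius (a j) (q j x) := by have := hM j; linarith
      have hcont : Continuous fun y ↦ Kerr.radius (a j) (q j y) := by
        have hqj : q j = poincareInv (Λ j) (E4.ofTimeSpace 0 (p j)) := funext (hq j)
        rw [hqj]
        exact (Kerr.continuous_radius (a j)).comp (continuous_poincareInv _ _)
      exact (continuousAt_const.eventually_lt hcont.continuousAt h16).mono fun y hy _ ↦ hy
  have hGev : ∀ α β : Fin 4, (fun y ↦ G y α β) =ᶠ[𝓝 x]
      fun y ↦ Minkowski.bilin (E4.basisVector α) (E4.basisVector β) - T i y α β := by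
    intro α β
    filter_upwards [hnear] with y hy
    rw [hG', Finset.sum_eq_single i (fun j _ hji ↦ ?_) fun h ↦ absurd (Finset.mem_univ i) h]
    rw [← hT, Theorems.cruxCutoff_eq_zero (hM j) (hy j hji).le]
    ring
  -- (3) the directional derivative along `u i` vanishes (uniqueness of line derivatives)
  have hfd : ∀ α β : Fin 4, fderiv ℝ (fun y ↦ G y α β) x (u i) = 0 := by
    intro α β
    by_cases hd : DifferentiableAt ℝ (fun y ↦ G y α β) x
    · have h1 : HasLineDerivAt ℝ (fun y ↦ G y α β) (fderiv ℝ (fun y ↦ G y α β) x (u i)) x (u i) :=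
        hd.hasFDerivAt.hasLineDerivAt _
      have h2 : HasLineDerivAt ℝ
          (fun y ↦ Minkowski.bilin (E4.basisVector α) (E4.basisVector β) - T i y α β) 0 x (u i) := by
        show HasDerivAt (fun s : ℝ ↦
          Minkowski.bilin (E4.basisVector α) (E4.basisVector β) - T i (x + s • u i) α β) 0 0
        simp only [hTi]
        exact hasDerivAt_const _ _
      exact h1.unique (h2.congr_of_eventuallyEq (hGev α β))
    · simp [fderiv_zero_of_not_differentiableAt hd]
  refine ⟨hfd, fun w ↦ ?_⟩
  -- (4) the bulk of the constant multiplier `u i`: `∂X = 0`, and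
  -- `Σ_μ uᵢ^μ ∂_μ G^{αβ} = DG^{αβ}(x) uᵢ = 0`
  have hdir : ∀ α β : Fin 4,
      ∑ μ, u i μ * fderiv ℝ (fun y ↦ G y α β) x (E4.basisVector μ) = 0 := by
    intro α β
    have h := hfd α β
    rw [Kerr.eq_sum_basisVector (u i), map_sum] at h
    simpa only [map_smul, smul_eq_mul] using h
  rw [KerrSchild.multiplierBulk_of_fderiv_eq_zero G w fun α ↦ by simp]
  have key : ∑ μ, u i μ * ∑ α, ∑ β, fderiv ℝ (fun y ↦ G y α β) x (E4.basisVector μ) *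
      fderiv ℝ w x (E4.basisVector α) * fderiv ℝ w x (E4.basisVector β) =
      ∑ α, ∑ β, (∑ μ, u i μ * fderiv ℝ (fun y ↦ G y α β) x (E4.basisVector μ)) *
        fderiv ℝ w x (E4.basisVector α) * fderiv ℝ w x (E4.basisVector β) := by
    simp only [Finset.mul_sum, Finset.sum_mul]
    rw [Finset.sum_comm]
    refine Finset.sum_congr rfl fun α _ ↦ ?_
    rw [Finset.sum_comm]
    refine Finset.sum_congr rfl fun β _ ↦ Finset.sum_congr rfl fun μ _ ↦ ?_
    ring
  rw [key]
  simp [hdir]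

end Summit.FinalStateConjecture.FinalStateConjecture.Cruxes.AdiabaticMultiKerrILED.Sketch

end
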